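import Literature.Geometry.Kaehler.ComplexTorusEquivariantEndomorphismAlgebraCommutantCyclicCMType
import Literature.Geometry.Kaehler.ComplexTorusCyclotomicAutomorphismFixedPoints
import Literature.Geometry.Kaehler.ComplexTorusAutomorphismOrder
import HarnessLib

/-!
# The fixed points of a CM automorphism, computably: `#X^δ = P^r_δ(1) = Π_{d ∈ D} Φ_d(1) = Π_{ℓ^k ∈ D} ℓ`

Layer `Literature/Geometry/Kaehler`, namespace `Literature.Geometry.Kaehler.ComplexTorus`; lane `lit-hodgefound`
(Track 2 foundations library), Layer A2, row «A2-26(ew)» (self-proposed 2026-08-28, prover seat `lit-hodgefound-p10`,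
generation 27, FILE 5).  Sequel of FILE 2 `…CommutantCyclicCyclotomic.lean` (`d ∈ D = eigenvalueOrders n u ⟺ Φ_d ∣ P^r_u`,
`P^r_u` squarefree `⟺ P^r_u = Π_{d ∈ D} Φ_d`) and FILE 4 `…CommutantCyclicCMType.lean` (`P^r_u > 0` on `ℝ`, `1, 2 ∉ D`),
and of seat p11's `ComplexTorusCyclotomicAutomorphismFixedPoints.lean` (Dolgachev–Zarhin §2.2: the fixed group
`X^δ = fixedSubgroup Φ D = Ker(1_X − δ)`, `#X^δ = |det(1 − ρ_r(δ))|`, and — for ONE cyclotomic factor, `Φ_n(δ) = 0`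
— `#X^δ = Φ_n(1)^{rk Λ/φ(n)}`: `ℓ^{2g/(ℓ−1)}` for `n = ℓ` prime, trivial for `n` not a prime power).  THIS FILE is
the SQUAREFREE MULTI-FACTOR case: for an automorphism `δ` of `X` (integral rational representation `D`,
`u = ρ_r(δ) ⊗ 1 ∈ End_ℚ(X)`) of finite order with squarefree `P^r_δ` — the CM case of FILES 1–4 — the number of
fixed points is READ OFF the characteristic polynomial: `#X^δ = P^r_δ(1) = Π_{d ∈ D} Φ_d(1)`, and `Φ_d(1) = ℓ` for
`d = ℓ^k` a prime power (`k ≥ 1`), `Φ_d(1) = 1` otherwise (`d ≥ 3` throughout, FILE 4).  CONSUMED BY NAME, nothing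
restated: p11's `fixedSubgroup` / `natCard_fixedSubgroup` / `mem_fixedSubgroup_iff`, `ComplexTorusLefschetzNumber`'s
`natCard_fixedPoints_mapMatrix_add` (translates `t_c ∘ δ`), FILE 2's `mem_eigenvalueOrders_iff_cyclotomic_dvd_charpoly` /
`squarefree_charpoly_coe_iff_charpoly_eq_prod_cyclotomic` / `squarefree_prod_cyclotomic`, FILE 4's `eval_charpoly_pos` /
`one_not_mem_eigenvalueOrders_of_squarefree_charpoly` / `eigenvalueOrders_rotOmegaEnd`, FILE 3's `gaussEnd_pow_four` /
`squarefree_charpoly_gaussJ` / `gaussOmegaEnd_pow_twelve` / `charpoly_gaussOmega`, seat p38's `rotI` / `rotOmega` /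
`surfaceAutMatrix` / `surfacePeriod` (`ComplexTorusAutomorphismOrder`), `charpoly_gaussJ` (`= Φ₄`,
`ComplexTorusSimpleEndomorphismMinpoly`), and Mathlib's `eval_one_cyclotomic_prime_pow` /
`eval_one_cyclotomic_not_prime_pow` / `cyclotomic_injective`.  Theorems only; NO definition, NO named fact (D-0026, net
debt 0).

## The print

* I. Dolgachev, Yu. G. Zarhin, *Endomorphisms of Complex Abelian Varieties* (2024; held text
  `paper:galaxy-pdf-8712177384607648460`), §2.2 p0033–p0034 (2.15)–(2.17), VERBATIM: «Let `A^δ = {x ∈ A ∣ δ(x) = x}`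
  be the subgroup of fixed points of `δ` […] `A^δ ≅ Λ/(1 − δ)Λ` […] `σ` acts freely […] `1` is not an eigenvalue»,
  and Lemma 2.19 / Thm. 2.18 (p0035–p0036).  There `Φ_ℓ(δ) = 0`; here `P^r_δ = Π_{d ∈ D} Φ_d` is any squarefree
  product, and `Λ/(1 − δ)Λ` is counted by `|det(1 − ρ_r(δ))| = P^r_δ(1) = Π_{d ∈ D} Φ_d(1)`.
* H. Lange, *Abelian Varieties over the Complex Numbers* (2023), §2.4.1 Prop. 2.4.3 (b) (p0114: «`deg f = P^r_f(0)`»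
  applied to `1_X − f`: `#Ker(1_X − f) = P^r_f(1)`), and Ch. Birkenhake–Lange *Complex Abelian Varieties* Ch. 13 §1
  (the holomorphic Lefschetz fixed-point formula `#Fix(f) = |det(1 − ρ_a(f))|²`; the tree's
  `natCard_fixedPoints_eq_normSq_det`).
* A. Carocca, H. Lange, R. E. Rodríguez, *Abelian varieties with finite abelian group action*, Arch. Math. 112
  (2019), §2.2 (p0004): «`d_i | n` denote the orders of the eigenvalues of `α`» — §1 below reads `D` off `P^r_u`.
* Mathlib, `RingTheory/Polynomial/Cyclotomic/Eval`: `Φ_{p^{k+1}}(1) = p`, `Φ_n(1) = 1` for `n` not a prime power.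

## What is proved (`X = E/Φ(ℤ^ι)`; `u ∈ End_ℚ(X)` with `uⁿ = 1`, `D = eigenvalueOrders n u`; from §2 on `u = D_ℚ`
for an integer matrix `D`, i.e. `u = ρ_r(δ)` for `δ = mapMatrix Φ Φ D ∈ End(X)`, and `X^δ = fixedSubgroup Φ D`)

* §1 READING `D` OFF `P^r_u` (any `u ∈ End_ℚ(X)` with `uⁿ = 1`): **`eigenvalueOrders_eq_of_charpoly_eq_prod_cyclotomic`**
  (`P^r_u = Π_{d ∈ S} Φ_d` with `S ⊆ {d | n}` ⟹ `D = S`), `eigenvalueOrders_eq_singleton_of_charpoly_eq_cyclotomic`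
  (`P^r_u = Φ_m ⟹ D = {m}`), `squarefree_charpoly_of_eq_prod_cyclotomic`, `eval_one_charpoly_eq_prod_of_squarefree_charpoly`
  (**`P^r_u(1) = Π_{d ∈ D} Φ_d(1)`**), `eval_one_cyclotomic_eq_ite` (`Φ_d(1) = ℓ` or `1` for `d ∈ D`),
  `eval_one_charpoly_eq_prod_minFac` (`P^r_u(1) = Π_{d ∈ D prime power} ℓ_d`).
* §2 THE FIXED GROUP OF AN INTEGRAL `u = D_ℚ`: `charpoly_coe_eq_map_charpoly`, `intCast_det_one_sub_eq_eval_one`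
  (`det(1 − D) = P^r_u(1)`), and for squarefree `P^r_u` (no finite order needed): `det_one_sub_pos_of_squarefree_charpoly`,
  **`natCard_fixedSubgroup_eq_eval_one`** (`#X^δ = P^r_u(1)` as an integer), `finite_fixedSubgroup_of_squarefree_charpoly`,
  `natCard_fixedSubgroup_pos`, `natCard_fixedPoints_add_eq_natCard_fixedSubgroup` (every translate `t_c ∘ δ` has the
  same number of fixed points).
* §3 FINITE ORDER, SQUAREFREE: **`natCard_fixedSubgroup_eq_prod_eval_one_cyclotomic`** (`#X^δ = Π_{d ∈ D} Φ_d(1)`),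
  **`natCard_fixedSubgroup_eq_prod_minFac`** (`#X^δ = Π_{d ∈ D, d a prime power} minFac d`, in `ℕ`),
  `natCard_fixedSubgroup_eq_one_iff` (`X^δ = 0 ⟺` no eigenvalue order is a prime power),
  `fixedSubgroup_eq_bot_iff`, `prime_dvd_natCard_fixedSubgroup_iff` (`ℓ | #X^δ ⟺ ℓ^k ∈ D` for some `k ≥ 1`),
  `natCard_fixedSubgroup_dvd_prod` / `nsmul_eq_zero_of_mem_fixedSubgroup` (`X^δ` is killed by `#X^δ`).
* §4 INSTANCES: `eigenvalueOrders_gaussEnd` (`E_i`: `D = {4}`), **`natCard_fixedSubgroup_rotI`** (`#E_i^{i} = 2`),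
  **`natCard_fixedSubgroup_rotOmega`** (`#E_ω^{ω} = 3`), `eigenvalueOrders_surfaceAut` (`E_i × E_ω`, `(i, ω)` of order
  `12`: `D = {4, 3}`), **`natCard_fixedSubgroup_surfaceAutMatrix`** (`#(E_i × E_ω)^{(i,ω)} = 6`).

## References

* [DolgachevZarhin2024] I. Dolgachev, Yu. G. Zarhin, *Endomorphisms of Complex Abelian Varieties* (2024), §2.2
  (2.15)–(2.19), Lemma 2.19, Thm. 2.18.
* [Lange2023AbelianVarietiesComplex] H. Lange, *Abelian Varieties over the Complex Numbers* (2023), §2.4.1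
  Prop. 2.4.3, §2.4.5 Exercise (10).
* [LangeBirkenhake1992] H. Lange, Ch. Birkenhake, *Complex Abelian Varieties* (1992), Ch. 13 §1.
* [CaroccaLangeRodriguez2019] A. Carocca, H. Lange, R. E. Rodríguez, Arch. Math. 112 (2019), §2.2.
* [LangeRodriguez2022] H. Lange, R. E. Rodríguez, *Decomposition of Jacobians by Prym Varieties*, LNM 2310 (2022),
  §6.1.1 Prop. 6.1.2.
-/

noncomputable section

open Module Function Polynomial Finset
open scoped Matrix

namespace Literature.Geometry.Kaehler

namespace ComplexTorus

open CyclotomicIdempotents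

universe u

variable {ι : Type u} [Fintype ι] [DecidableEq ι] {E : Type*} [NormedAddCommGroup E] [NormedSpace ℂ E]
  {Φ : (ι → ℝ) ≃L[ℝ] E} {n : ℕ} {u : endAlgRat Φ}

/-! ### §1 Reading `D` off `P^r_u`, and `P^r_u(1) = Π_{d ∈ D} Φ_d(1)` -/

section ReadingD

/-- **`P^r_u = Π_{d ∈ S} Φ_d` with `S ⊆ {d | n}` ⟹ `D = S`**: the eigenvalue orders are read off the factorisation
of the characteristic polynomial (`d ∈ D ⟺ Φ_d ∣ P^r_u`, FILE 2; distinct cyclotomic polynomials are coprime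
irreducibles). [cite: CaroccaLangeRodriguez2019, §2.2 («the orders of the eigenvalues of `α`»), p0004] [cite: LangeRodriguez2022, §6.1.1 Prop. 6.1.2, p0153] -/
theorem eigenvalueOrders_eq_of_charpoly_eq_prod_cyclotomic (hn : 0 < n) (hu : u ^ n = 1) {S : Finset ℕ}
    (hS : S ⊆ n.divisors) (h : (u : Matrix ι ι ℚ).charpoly = ∏ d ∈ S, cyclotomic d ℚ) :
    eigenvalueOrders n u = S := by
  ext d
  rw [mem_eigenvalueOrders_iff_cyclotomic_dvd_charpoly hn hu, h]
  constructor
  · rintro ⟨hd, hdvd⟩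
    have hd0 : 0 < d := Nat.pos_of_mem_divisors hd
    obtain ⟨d', hd', hdd'⟩ := ((cyclotomic.irreducible_rat hd0).prime.dvd_finsetProd_iff _).1 hdvd
    have hd'0 : 0 < d' := Nat.pos_of_mem_divisors (hS hd')
    have heq : cyclotomic d ℚ = cyclotomic d' ℚ :=
      eq_of_monic_of_associated (cyclotomic.monic d ℚ) (cyclotomic.monic d' ℚ)
        ((cyclotomic.irreducible_rat hd0).associated_of_dvd (cyclotomic.irreducible_rat hd'0) hdd')
    rw [cyclotomic_injective heq]
    exact hd'
  · intro hd
    exact ⟨hS hd, Finset.dvd_prod_of_mem _ hd⟩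

/-- `P^r_u = Φ_m`, `m | n` ⟹ **`D = {m}`**. [cite: CaroccaLangeRodriguez2019, §2.2, p0004] -/
theorem eigenvalueOrders_eq_singleton_of_charpoly_eq_cyclotomic (hn : 0 < n) (hu : u ^ n = 1) {m : ℕ} (hm : m ∣ n)
    (h : (u : Matrix ι ι ℚ).charpoly = cyclotomic m ℚ) : eigenvalueOrders n u = {m} :=
  eigenvalueOrders_eq_of_charpoly_eq_prod_cyclotomic hn hu
    (Finset.singleton_subset_iff.2 (Nat.mem_divisors.2 ⟨hm, hn.ne'⟩)) (by rw [Finset.prod_singleton, h])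

/-- `P^r_u = Π_{d ∈ S} Φ_d` with `S ⊆ {d | n}` ⟹ `P^r_u` is squarefree. [cite: LangeRodriguez2022, §6.1.1 Prop. 6.1.2, p0153] -/
theorem squarefree_charpoly_of_eq_prod_cyclotomic (hn : 0 < n) {S : Finset ℕ} (hS : S ⊆ n.divisors)
    (h : (u : Matrix ι ι ℚ).charpoly = ∏ d ∈ S, cyclotomic d ℚ) : Squarefree (u : Matrix ι ι ℚ).charpoly := by
  rw [h]
  exact squarefree_prod_cyclotomic hn hS

/-- Squarefree `P^r_u`, `uⁿ = 1` ⟹ **`P^r_u(1) = Π_{d ∈ D} Φ_d(1)`**. [cite: DolgachevZarhin2024, §2.2 (2.15)–(2.17), p0033–p0034]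
[cite: LangeRodriguez2022, §6.1.1 Prop. 6.1.2, p0153] -/
theorem eval_one_charpoly_eq_prod_of_squarefree_charpoly (hn : 0 < n) (hu : u ^ n = 1)
    (hsq : Squarefree (u : Matrix ι ι ℚ).charpoly) :
    (u : Matrix ι ι ℚ).charpoly.eval 1 = ∏ d ∈ eigenvalueOrders n u, (cyclotomic d ℚ).eval 1 := by
  rw [(squarefree_charpoly_coe_iff_charpoly_eq_prod_cyclotomic hn hu).1 hsq, eval_prod]

/-- `Φ_d(1)` as an integer for `d ≥ 2`: `ℓ` if `d` is a power of the prime `ℓ`, `1` otherwise. [folklore] -/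
private theorem eval_one_cyclotomic_int_eq_ite {d : ℕ} (hd : 2 ≤ d) :
    (cyclotomic d ℤ).eval 1 = if IsPrimePow d then (d.minFac : ℤ) else 1 := by
  split_ifs with h
  · obtain ⟨p, k, hp, hk, rfl⟩ := (isPrimePow_nat_iff _).1 h
    obtain ⟨k, rfl⟩ := Nat.exists_eq_succ_of_ne_zero hk.ne'
    haveI := Fact.mk hp
    rw [eval_one_cyclotomic_prime_pow, hp.pow_minFac (Nat.succ_ne_zero k)]
  · refine eval_one_cyclotomic_not_prime_pow fun {p} hp k hk ↦ ?_
    rcases k.eq_zero_or_pos with rfl | hk0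
    · rw [pow_zero] at hk; omega
    · exact h ⟨p, k, hp.prime, hk0, hk⟩

/-- `Φ_d(1)` in `ℚ` is the integer `Φ_d(1)`. [folklore] -/
private theorem eval_one_cyclotomic_rat_eq_intCast (d : ℕ) :
    (cyclotomic d ℚ).eval 1 = (((cyclotomic d ℤ).eval 1 : ℤ) : ℚ) := by
  rw [← map_cyclotomic_int d ℚ, eval_one_map, eq_intCast]

variable [FiniteDimensional ℂ E]

/-- Squarefree `P^r_u`, `uⁿ = 1`, `d ∈ D` ⟹ **`Φ_d(1) = ℓ` if `d = ℓ^k` is a prime power, `= 1` otherwise** (`d ≥ 3` by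
FILE 4, so `Φ_1(1) = 0` does not occur). [cite: DolgachevZarhin2024, §2.2 (2.15) («`Λ/(1−δ)Λ ≅ 𝔽_ℓ^r`»), p0034] -/
theorem eval_one_cyclotomic_eq_ite (hn : 0 < n) (hu : u ^ n = 1) (hsq : Squarefree (u : Matrix ι ι ℚ).charpoly)
    {d : ℕ} (hd : d ∈ eigenvalueOrders n u) :
    (cyclotomic d ℤ).eval 1 = if IsPrimePow d then (d.minFac : ℤ) else 1 :=
  eval_one_cyclotomic_int_eq_ite
    ((three_le_of_mem_eigenvalueOrders_of_squarefree_charpoly hn hu hsq hd).trans' (by norm_num))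

open scoped Classical in
/-- Squarefree `P^r_u`, `uⁿ = 1` ⟹ **`P^r_u(1) = Π_{d ∈ D, d a prime power} ℓ_d`** (`ℓ_d = minFac d` the prime under
`d`). [cite: DolgachevZarhin2024, §2.2 (2.15)–(2.17), p0033–p0034] -/
theorem eval_one_charpoly_eq_prod_minFac (hn : 0 < n) (hu : u ^ n = 1) (hsq : Squarefree (u : Matrix ι ι ℚ).charpoly) :
    (u : Matrix ι ι ℚ).charpoly.eval 1 = (((∏ d ∈ (eigenvalueOrders n u).filter IsPrimePow, d.minFac : ℕ) : ℤ) : ℚ) := by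
  rw [eval_one_charpoly_eq_prod_of_squarefree_charpoly hn hu hsq, Nat.cast_prod, Int.cast_prod, Finset.prod_filter]
  refine Finset.prod_congr rfl fun d hd ↦ ?_
  rw [eval_one_cyclotomic_rat_eq_intCast, eval_one_cyclotomic_eq_ite hn hu hsq hd]
  split_ifs <;> simp

end ReadingD

/-! ### §2 The fixed group `X^δ` of an integral `u = D_ℚ` with squarefree `P^r_u` -/

section Integral

variable {D : Matrix ι ι ℤ}

/-- `P^r_u = P_D` (the integer characteristic polynomial, base-changed). [cite: Lange2023AbelianVarietiesComplex, §1.1.2 (`ρ_r` integral on `End(X)`), p. 20] -/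
theorem charpoly_coe_eq_map_charpoly (hD : (u : Matrix ι ι ℚ) = D.map (Int.cast : ℤ → ℚ)) :
    (u : Matrix ι ι ℚ).charpoly = D.charpoly.map (Int.castRingHom ℚ) := by
  rw [hD, show (Int.cast : ℤ → ℚ) = Int.castRingHom ℚ from rfl, Matrix.charpoly_map]

/-- **`det(1 − D) = P^r_u(1)`.** [cite: DolgachevZarhin2024, §2.2 (2.15) («`A^δ ≅ Λ/(1 − δ)Λ`»), p0034] [cite: Lange2023AbelianVarietiesComplex, §2.4.1 Prop. 2.4.3 (b)] -/
theorem intCast_det_one_sub_eq_eval_one (hD : (u : Matrix ι ι ℚ) = D.map (Int.cast : ℤ → ℚ)) :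
    (((1 - D).det : ℤ) : ℚ) = (u : Matrix ι ι ℚ).charpoly.eval 1 := by
  rw [charpoly_coe_eq_map_charpoly hD, eval_one_map, eq_intCast, Matrix.eval_charpoly, map_one]

variable [FiniteDimensional ℂ E]

/-- Squarefree `P^r_u` ⟹ **`det(1 − D) > 0`** (`P^r_u > 0` on `ℝ`, FILE 4). [cite: DolgachevZarhin2024, §2.2 (2.17) («`1` is not an eigenvalue»), p0034] -/
theorem det_one_sub_pos_of_squarefree_charpoly (hD : (u : Matrix ι ι ℚ) = D.map (Int.cast : ℤ → ℚ))
    (hsq : Squarefree (u : Matrix ι ι ℚ).charpoly) : 0 < (1 - D).det := by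
  have h := eval_charpoly_pos hsq 1
  rw [← intCast_det_one_sub_eq_eval_one hD] at h
  exact_mod_cast h

/-- Squarefree `P^r_u` ⟹ **`#X^δ = P^r_u(1)`** (`X^δ = Ker(1_X − δ)`, `#Ker = |det ρ_r| = det(1 − D) > 0`).
[cite: DolgachevZarhin2024, §2.2 (2.15), p0034] [cite: Lange2023AbelianVarietiesComplex, §2.4.1 Prop. 2.4.3 (b)] -/
theorem natCard_fixedSubgroup_eq_eval_one (hD : (u : Matrix ι ι ℚ) = D.map (Int.cast : ℤ → ℚ))
    (hsq : Squarefree (u : Matrix ι ι ℚ).charpoly) :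
    ((Nat.card (fixedSubgroup Φ D) : ℤ) : ℚ) = (u : Matrix ι ι ℚ).charpoly.eval 1 := by
  rw [natCard_fixedSubgroup Φ D, Int.natCast_natAbs, abs_of_pos (det_one_sub_pos_of_squarefree_charpoly hD hsq),
    intCast_det_one_sub_eq_eval_one hD]

/-- Squarefree `P^r_u` ⟹ `#X^δ = det(1 − D)` in `ℤ`. [cite: DolgachevZarhin2024, §2.2 (2.15), p0034] -/
theorem natCard_fixedSubgroup_eq_det (hD : (u : Matrix ι ι ℚ) = D.map (Int.cast : ℤ → ℚ))
    (hsq : Squarefree (u : Matrix ι ι ℚ).charpoly) : (Nat.card (fixedSubgroup Φ D) : ℤ) = (1 - D).det := by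
  rw [natCard_fixedSubgroup Φ D, Int.natCast_natAbs, abs_of_pos (det_one_sub_pos_of_squarefree_charpoly hD hsq)]

/-- Squarefree `P^r_u` ⟹ **`X^δ` is non-empty and finite: `#X^δ ≥ 1`** (as `Nat.card`, `0` would mean infinite).
[cite: DolgachevZarhin2024, §2.2 (2.15)–(2.17), p0034] -/
theorem natCard_fixedSubgroup_pos (hD : (u : Matrix ι ι ℚ) = D.map (Int.cast : ℤ → ℚ))
    (hsq : Squarefree (u : Matrix ι ι ℚ).charpoly) : 0 < Nat.card (fixedSubgroup Φ D) := by
  have h := natCard_fixedSubgroup_eq_det hD hsq (Φ := Φ)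
  have h' := det_one_sub_pos_of_squarefree_charpoly hD hsq
  omega

/-- Squarefree `P^r_u` ⟹ `X^δ` is finite. [cite: DolgachevZarhin2024, §2.2 (2.15), p0034] -/
theorem finite_fixedSubgroup_of_squarefree_charpoly (hD : (u : Matrix ι ι ℚ) = D.map (Int.cast : ℤ → ℚ))
    (hsq : Squarefree (u : Matrix ι ι ℚ).charpoly) : Finite (fixedSubgroup Φ D) :=
  Nat.finite_of_card_ne_zero (natCard_fixedSubgroup_pos hD hsq).ne'

omit [FiniteDimensional ℂ E] in
/-- Every translate `t_c ∘ δ` has as many fixed points as `δ`: `#Fix(t_c ∘ δ) = #X^δ` (both `= |det(1 − D)|`; as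
`Nat.card`, `0` iff infinite). [cite: LangeBirkenhake1992, Ch. 13 §1 (holomorphic Lefschetz fixed-point formula)]
[cite: DolgachevZarhin2024, §2.2 (2.15), p0034] -/
theorem natCard_fixedPoints_add_eq_natCard_fixedSubgroup (D : Matrix ι ι ℤ) (c : ComplexTorus Φ) :
    Nat.card (fixedPoints fun y ↦ mapMatrix Φ Φ D y + c) = Nat.card (fixedSubgroup Φ D) := by
  rw [natCard_fixedPoints_mapMatrix_add Φ D c, natCard_fixedSubgroup Φ D]

end Integral

/-! ### §3 Finite order, squarefree `P^r_u`: `#X^δ = Π_{d ∈ D} Φ_d(1) = Π_{ℓ^k ∈ D} ℓ` -/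

section FiniteOrder

variable [FiniteDimensional ℂ E] {D : Matrix ι ι ℤ}

/-- **`#X^δ = Π_{d ∈ D} Φ_d(1)`** for an automorphism `δ` of finite order with squarefree `P^r_δ` (the squarefree
multi-factor form of Dolgachev–Zarhin's `#A^δ = |P_δ(1)| = ℓ^r`). [cite: DolgachevZarhin2024, §2.2 (2.15)–(2.17), p0033–p0034]
[cite: LangeRodriguez2022, §6.1.1 Prop. 6.1.2, p0153] -/
theorem natCard_fixedSubgroup_eq_prod_eval_one_cyclotomic (hD : (u : Matrix ι ι ℚ) = D.map (Int.cast : ℤ → ℚ))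
    (hn : 0 < n) (hu : u ^ n = 1) (hsq : Squarefree (u : Matrix ι ι ℚ).charpoly) :
    (Nat.card (fixedSubgroup Φ D) : ℤ) = ∏ d ∈ eigenvalueOrders n u, (cyclotomic d ℤ).eval 1 := by
  have h := natCard_fixedSubgroup_eq_eval_one hD hsq (Φ := Φ)
  rw [eval_one_charpoly_eq_prod_of_squarefree_charpoly hn hu hsq] at h
  simp_rw [eval_one_cyclotomic_rat_eq_intCast] at h
  rw [← Int.cast_prod] at h
  exact_mod_cast h

open scoped Classical in
/-- **`#X^δ = Π_{d ∈ D, d a prime power} ℓ_d`** (`ℓ_d` the prime under `d`): a natural number read off `D`.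
[cite: DolgachevZarhin2024, §2.2 (2.15) («`A^δ ≅ 𝔽_ℓ^r`»), p0034] -/
theorem natCard_fixedSubgroup_eq_prod_minFac (hD : (u : Matrix ι ι ℚ) = D.map (Int.cast : ℤ → ℚ))
    (hn : 0 < n) (hu : u ^ n = 1) (hsq : Squarefree (u : Matrix ι ι ℚ).charpoly) :
    Nat.card (fixedSubgroup Φ D) = ∏ d ∈ (eigenvalueOrders n u).filter IsPrimePow, d.minFac := by
  have h := natCard_fixedSubgroup_eq_eval_one hD hsq (Φ := Φ)
  rw [eval_one_charpoly_eq_prod_minFac hn hu hsq] at h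
  exact_mod_cast h

/-- **`X^δ = 0 ⟺` no eigenvalue order of `δ` is a prime power** (`#X^δ = 1`). [cite: DolgachevZarhin2024, §2.2 (2.15)–(2.17), p0034] -/
theorem natCard_fixedSubgroup_eq_one_iff (hD : (u : Matrix ι ι ℚ) = D.map (Int.cast : ℤ → ℚ))
    (hn : 0 < n) (hu : u ^ n = 1) (hsq : Squarefree (u : Matrix ι ι ℚ).charpoly) :
    Nat.card (fixedSubgroup Φ D) = 1 ↔ ∀ d ∈ eigenvalueOrders n u, ¬ IsPrimePow d := by
  classical
  rw [natCard_fixedSubgroup_eq_prod_minFac hD hn hu hsq,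
    Finset.prod_eq_one_iff_of_one_le' fun d _ ↦ Nat.minFac_pos d]
  simp only [Finset.mem_filter, and_imp]
  constructor
  · intro h d hd hpp
    have h3 := three_le_of_mem_eigenvalueOrders_of_squarefree_charpoly hn hu hsq hd
    have h1 := Nat.minFac_eq_one_iff.1 (h d hd hpp)
    omega
  · intro h d hd hpp
    exact absurd hpp (h d hd)

/-- `X^δ = 0` as a subgroup iff no eigenvalue order is a prime power. [cite: DolgachevZarhin2024, §2.2 (2.15)–(2.17), p0034] -/
theorem fixedSubgroup_eq_bot_iff (hD : (u : Matrix ι ι ℚ) = D.map (Int.cast : ℤ → ℚ))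
    (hn : 0 < n) (hu : u ^ n = 1) (hsq : Squarefree (u : Matrix ι ι ℚ).charpoly) :
    fixedSubgroup Φ D = ⊥ ↔ ∀ d ∈ eigenvalueOrders n u, ¬ IsPrimePow d := by
  rw [AddSubgroup.eq_bot_iff_card, natCard_fixedSubgroup_eq_one_iff hD hn hu hsq]

/-- **`ℓ ∣ #X^δ ⟺ ℓ^k ∈ D` for some `k ≥ 1`** (`ℓ` prime). [cite: DolgachevZarhin2024, §2.2 (2.15) («`dim_{𝔽_ℓ} A^δ = r`»), p0034] -/
theorem prime_dvd_natCard_fixedSubgroup_iff (hD : (u : Matrix ι ι ℚ) = D.map (Int.cast : ℤ → ℚ))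
    (hn : 0 < n) (hu : u ^ n = 1) (hsq : Squarefree (u : Matrix ι ι ℚ).charpoly) {p : ℕ} (hp : p.Prime) :
    p ∣ Nat.card (fixedSubgroup Φ D) ↔ ∃ k : ℕ, p ^ (k + 1) ∈ eigenvalueOrders n u := by
  classical
  rw [natCard_fixedSubgroup_eq_prod_minFac hD hn hu hsq, (Nat.prime_iff.1 hp).dvd_finsetProd_iff]
  simp only [Finset.mem_filter]
  constructor
  · rintro ⟨d, ⟨hd, hpp⟩, hdvd⟩
    have h3 := three_le_of_mem_eigenvalueOrders_of_squarefree_charpoly hn hu hsq hd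
    obtain ⟨q, k, hq, hk, rfl⟩ := (isPrimePow_nat_iff _).1 hpp
    obtain ⟨k, rfl⟩ := Nat.exists_eq_succ_of_ne_zero hk.ne'
    rw [hq.pow_minFac (Nat.succ_ne_zero k)] at hdvd
    rw [(Nat.prime_dvd_prime_iff_eq hp hq).1 hdvd]
    exact ⟨k, hd⟩
  · rintro ⟨k, hk⟩
    exact ⟨p ^ (k + 1), ⟨hk, hp.isPrimePow.pow (Nat.succ_ne_zero k)⟩,
      by rw [hp.pow_minFac (Nat.succ_ne_zero k)]⟩

open scoped Classical in
/-- **`X^δ ⊆ X[N]` with `N = Π_{ℓ^k ∈ D} ℓ = #X^δ`.** [cite: DolgachevZarhin2024, §2.2 (2.16) («`A^δ ⊆ A[ℓ]`»), p0034] -/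
theorem prod_minFac_nsmul_eq_zero (hD : (u : Matrix ι ι ℚ) = D.map (Int.cast : ℤ → ℚ))
    (hn : 0 < n) (hu : u ^ n = 1) (hsq : Squarefree (u : Matrix ι ι ℚ).charpoly) {t : ComplexTorus Φ}
    (ht : t ∈ fixedSubgroup Φ D) : (∏ d ∈ (eigenvalueOrders n u).filter IsPrimePow, d.minFac) • t = 0 := by
  haveI : Finite (fixedSubgroup Φ D) := finite_fixedSubgroup_of_squarefree_charpoly hD hsq
  have h : Nat.card (fixedSubgroup Φ D) • (⟨t, ht⟩ : fixedSubgroup Φ D) = 0 := card_nsmul_eq_zero'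
  rw [natCard_fixedSubgroup_eq_prod_minFac hD hn hu hsq] at h
  have h' := congrArg ((↑) : fixedSubgroup Φ D → ComplexTorus Φ) h
  simpa only [AddSubgroupClass.coe_nsmul, ZeroMemClass.coe_zero] using h'

end FiniteOrder

/-! ### §4 Instances: `E_i` (`#Fix(i) = 2`), `E_ω` (`#Fix(ω) = 3`), `E_i × E_ω` (`#Fix(i, ω) = 6`) -/

section Examples

/-- `R_i ⊗ 1 = gaussJ`. [folklore] -/
private theorem rotI_map_intCast_eq_gaussJ : rotI.map (Int.cast : ℤ → ℚ) = gaussJ := by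
  ext i j
  fin_cases i <;> fin_cases j <;> simp [rotI, gaussJ]

/-- `Φ_4(1) = 2` in `ℤ`. [folklore] -/
private theorem eval_one_cyclotomic_four_int : (cyclotomic 4 ℤ).eval 1 = 2 := by
  have h := eval_one_cyclotomic_prime_pow (R := ℤ) (p := 2) 1
  norm_num at h
  exact h

/-- `Φ_3(1) = 3` in `ℤ`. [folklore] -/
private theorem eval_one_cyclotomic_three_int : (cyclotomic 3 ℤ).eval 1 = 3 := by
  haveI := Fact.mk Nat.prime_three
  have h := eval_one_cyclotomic_prime (R := ℤ) (p := 3)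
  exact_mod_cast h

variable (hI : Complex.I.im ≠ 0)

/-- **`E_i`: the eigenvalue orders of `i` are `D = {4}`** (`P^r_i = Φ_4`). [cite: CaroccaLangeRodriguez2019, §2.2, p0004] -/
theorem eigenvalueOrders_gaussEnd :
    eigenvalueOrders 4 (⟨gaussJ, gaussJ_mem_endAlgRat hI⟩ : endAlgRat (ellipticPeriod hI)) = {4} :=
  eigenvalueOrders_eq_singleton_of_charpoly_eq_cyclotomic (by norm_num) (gaussEnd_pow_four hI) (dvd_refl 4)
    charpoly_gaussJ

/-- **`E_i`: the automorphism `i` has exactly `2 = Φ_4(1)` fixed points** (`0` and `(1+i)/2`).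
[cite: DolgachevZarhin2024, §2.2 (2.15) (general form), p0034] [cite: LangeBirkenhake1992, Ch. 13 §1] -/
theorem natCard_fixedSubgroup_rotI : Nat.card (fixedSubgroup (ellipticPeriod hI) rotI) = 2 := by
  have h := natCard_fixedSubgroup_eq_prod_eval_one_cyclotomic (Φ := ellipticPeriod hI)
    (u := ⟨gaussJ, gaussJ_mem_endAlgRat hI⟩) rotI_map_intCast_eq_gaussJ.symm (by norm_num) (gaussEnd_pow_four hI)
    squarefree_charpoly_gaussJ
  rw [eigenvalueOrders_gaussEnd, Finset.prod_singleton, eval_one_cyclotomic_four_int] at h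
  exact_mod_cast h

/-- **`E_ω`: the automorphism `ω` has exactly `3 = Φ_3(1)` fixed points** (`D = {3}`, FILE 4).
[cite: DolgachevZarhin2024, §2.2 (2.15) («`#A^δ = ℓ^{2dim A/(ℓ−1)}`»), p0034] -/
theorem natCard_fixedSubgroup_rotOmega : Nat.card (fixedSubgroup (ellipticPeriod omega_im_ne_zero) rotOmega) = 3 := by
  have h := natCard_fixedSubgroup_eq_prod_eval_one_cyclotomic (Φ := ellipticPeriod omega_im_ne_zero)
    (u := rotOmegaEnd) rfl (by norm_num) rotOmegaEnd_pow_three squarefree_charpoly_rotOmegaEnd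
  rw [eigenvalueOrders_rotOmegaEnd, Finset.prod_singleton, eval_one_cyclotomic_three_int] at h
  exact_mod_cast h

/-- `B ⊗ 1 = diag(gaussJ, R_ω ⊗ 1)` for p38's `B = surfaceAutMatrix = diag(R_i, R_ω)`. [folklore] -/
private theorem surfaceAutMatrix_map_intCast :
    surfaceAutMatrix.map (Int.cast : ℤ → ℚ) = Matrix.fromBlocks gaussJ 0 0 (rotOmega.map (Int.cast : ℤ → ℚ)) := by
  rw [surfaceAutMatrix, Matrix.fromBlocks_map, rotI_map_intCast_eq_gaussJ, Matrix.map_zero _ Int.cast_zero]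

/-- `Φ_4 = x² + 1` over `ℚ`. [folklore] -/
private theorem cyclotomic_four_rat : cyclotomic 4 ℚ = X ^ 2 + 1 := by
  rw [← charpoly_gaussJ, charpoly_gaussJ_eq_X_sq_add_one]

/-- **`E_i × E_ω`: the eigenvalue orders of `(i, ω)` (order `12`) are `D = {4, 3}`** — read off
`P^r = (x² + 1)(x² + x + 1) = Φ_4 Φ_3` (FILE 3). [cite: CaroccaLangeRodriguez2019, §2.2, p0004] [cite: Lange2023AbelianVarietiesComplex, §2.4.5 Exercise (10)] -/
theorem eigenvalueOrders_surfaceAut :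
    eigenvalueOrders 12 (⟨Matrix.fromBlocks gaussJ 0 0 (rotOmega.map (Int.cast : ℤ → ℚ)), gaussOmega_mem_endAlgRat hI⟩ :
      endAlgRat (prodPeriod (ellipticPeriod hI) (ellipticPeriod omega_im_ne_zero))) = {4, 3} := by
  refine eigenvalueOrders_eq_of_charpoly_eq_prod_cyclotomic (by norm_num) (gaussOmegaEnd_pow_twelve hI) (by decide) ?_
  change (Matrix.fromBlocks gaussJ 0 0 (rotOmega.map (Int.cast : ℤ → ℚ))).charpoly = _
  rw [charpoly_gaussOmega, Finset.prod_pair (by norm_num), cyclotomic_four_rat, cyclotomic_three]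

/-- **`E_i × E_ω`: the automorphism `(z₁, z₂) ↦ (i z₁, ω z₂)` (p38's `surfaceAutMatrix`, order `12`) has exactly
`6 = Φ_4(1) Φ_3(1)` fixed points.** [cite: DolgachevZarhin2024, §2.2 (2.15) (general form), p0034] [cite: Lange2023AbelianVarietiesComplex, §2.4.5 Exercise (10)] -/
theorem natCard_fixedSubgroup_surfaceAutMatrix : Nat.card (fixedSubgroup surfacePeriod surfaceAutMatrix) = 6 := by
  have h := natCard_fixedSubgroup_eq_prod_eval_one_cyclotomic (Φ := surfacePeriod)
    (u := ⟨Matrix.fromBlocks gaussJ 0 0 (rotOmega.map (Int.cast : ℤ → ℚ)), gaussOmega_mem_endAlgRat I_im_ne_zero⟩)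
    surfaceAutMatrix_map_intCast.symm (by norm_num) (gaussOmegaEnd_pow_twelve I_im_ne_zero) squarefree_charpoly_gaussOmega
  have hD' : eigenvalueOrders 12 (⟨Matrix.fromBlocks gaussJ 0 0 (rotOmega.map (Int.cast : ℤ → ℚ)),
      gaussOmega_mem_endAlgRat I_im_ne_zero⟩ : endAlgRat surfacePeriod) = {4, 3} :=
    eigenvalueOrders_surfaceAut I_im_ne_zero
  rw [hD', Finset.prod_pair (by norm_num), eval_one_cyclotomic_four_int, eval_one_cyclotomic_three_int] at h
  exact_mod_cast h

end Examples

end ComplexTorus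

end Literature.Geometry.Kaehler
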